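import Mathlib
import Summits.RiemannHypothesis.RiemannHypothesis.Theorems.WeilFormatCPrimeFormBound
import Summits.RiemannHypothesis.RiemannHypothesis.Theorems.WeilFormatCJointShiftSOS
import Summits.RiemannHypothesis.RiemannHypothesis.Theorems.WeilFormatCJointShiftBoundA10397
import HarnessLib

/-!
# Format C: the PRIME block of Yoshida's Gram matrix is `⪰ −(2387/1000)·1` for windows `a ≤ 10397/10000`

Helper file (`--supports stmt-RiemannHypothesis-0098`, lead-track anchor; format C far bound), RH-free.  Seat
rh-explicit-weil-1.  This is the JOINT-PHANTOM replacement of weil-10's `WeilFormatC.primeCoeff_form_ge` (which gives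
the path-graph constant `A_op⁺(a)`, `= 3.129` on the `(log 7)/2…(log 8)/2` cell): for every `0 < a ≤ 10397/10000`, every
finite set of modes `s ⊆ ℤ` and all complex coefficients `c`,

* `WeilFormatC.primeCoeff_form_ge_joint` —
  **`−(2387/1000) · Σ_{n∈s} |c_n|² ≤ Σ_{n,m∈s} Re(conj c_n · c_m) · primeCoeff a n m`**

— the hypothesis `hP` of `WeilFormatC.farBlock_ge_dhat` with `A := 2387/1000`, uniform in `s` and in `a` on the
whole range (it covers the production abscissae `1`, `1039/1000`, `33π/100`).  Proof: weil-10's reduction of the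
prime form to `−Σ_k Λ(k)k^{−1/2}·2Re∫f(x+log k)conj f(x)` (`sum_sum_re_mul_incrCoeff_sub_two_eq`) with
`f = Σ c_nχ_n`; real and imaginary parts; the kernel-certified joint shift bound
`WeilFormatC.jointShiftBound_le_10397_real` (`WeilFormatCJointShiftBoundA10397.lean`, K2 torus-SOS certificate
`JointSOS.certA10397`, exact constant `certA10397.D ≤ 2387/1000`) applied to each part; and the bookkeeping
`weilPrimeIndex a ⊆ {0,…,7}` (`e^{2a} < 8`) with `Λ(0) = Λ(1) = Λ(6) = 0`, `Λ(4) = log 2`, shifts `≥ 2a` invisible.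
Standard axioms only; no definitions.
-/

set_option autoImplicit false
set_option linter.dupNamespace false

noncomputable section

open Complex Set MeasureTheory Finset
open scoped Real ComplexConjugate BigOperators ArithmeticFunction.vonMangoldt

namespace Summit.RiemannHypothesis.RiemannHypothesis.Theorems.WeilFormatC

open Literature.NumberTheory.LFunctions Literature.NumberTheory.LFunctions.Yoshida1992 JointSOS

/-! ## Real parts: the joint bound for a complex window function -/

section Joint

variable {a : ℝ} {f : ℝ → ℂ}

/-- For a real bounded measurable `u`: `∫ u(x+t) u(x) dx = ∫ u(x−t) u(x) dx` (translation invariance). -/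
theorem integral_shift_add_mul_eq_sub (u : ℝ → ℝ) (t : ℝ) :
    ∫ x, u (x + t) * u x = ∫ x, u (x - t) * u x := by
  have h := MeasureTheory.integral_add_right_eq_self (μ := volume) (fun y ↦ u y * u (y - t)) t
  simp only [add_sub_cancel_right] at h
  rw [h]
  exact integral_congr_ae (Filter.Eventually.of_forall fun x ↦ by simp only; ring)

/-- A shift by `|t| ≥ 2a` is invisible on the window, also in the non-strict case (the overlap is one point). -/
theorem integral_shift_mul_eq_zero_of_le {u : ℝ → ℝ} (hsupp : ∀ x, x ∉ Icc (-a) a → u x = 0) {t : ℝ}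
    (ht : 2 * a ≤ t) : ∫ x, u (x - t) * u x = 0 := by
  have hae : (fun x ↦ u (x - t) * u x) =ᵐ[volume] fun _ ↦ (0 : ℝ) := by
    have hnull : volume ({a} : Set ℝ) = 0 := Real.volume_singleton
    refine (ae_iff.2 ?_)
    refine measure_mono_null (fun x hx ↦ ?_) hnull
    simp only [Set.mem_setOf_eq] at hx
    simp only [Set.mem_singleton_iff]
    by_contra hxa
    by_cases hx1 : x ∈ Icc (-a) a
    · have hx2 : x - t ∉ Icc (-a) a := by
        intro h
        have h1 := hx1.2; have h2 := h.1
        have : x = a := by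
          rcases lt_or_eq_of_le h1 with hlt | heq
          · exfalso; linarith
          · exact heq
        exact hxa this
      exact hx (by rw [hsupp _ hx2, zero_mul])
    · exact hx (by rw [hsupp _ hx1, mul_zero])
  rw [integral_congr_ae hae, integral_zero]

/-- **Joint shift bound for a complex window function** (`a ≤ 10397/10000`): the five prime-power terms of the
window `e^{2a} < 8` satisfy `Σ_{n=2,3,4,5,7} 2Λ(n)/√n · Re∫ f(x+log n) conj f(x) dx ≤ certA10397.D · ∫‖f‖²`. -/
theorem joint_re_integral_shift_le (ha' : a ≤ 10397 / 10000) (hf : IsWindowFunction a f) :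
    2 * (Real.log 2 / Real.sqrt 2) * (∫ x, f (x + Real.log 2) * conj (f x)).re +
      2 * (Real.log 3 / Real.sqrt 3) * (∫ x, f (x + Real.log 3) * conj (f x)).re +
      2 * (Real.log 2 / 2) * (∫ x, f (x + 2 * Real.log 2) * conj (f x)).re +
      2 * (Real.log 5 / Real.sqrt 5) * (∫ x, f (x + Real.log 5) * conj (f x)).re +
      2 * (Real.log 7 / Real.sqrt 7) * (∫ x, f (x + Real.log 7) * conj (f x)).re
      ≤ (certA10397.D : ℝ) * ∫ x, ‖f x‖ ^ 2 := by
  obtain ⟨S, hS0, hS⟩ := hf.bounded'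
  have hre : ∀ x, |(f x).re| ≤ S := fun x ↦ (Complex.abs_re_le_norm _).trans (hS x)
  have him : ∀ x, |(f x).im| ≤ S := fun x ↦ (Complex.abs_im_le_norm _).trans (hS x)
  have hmr : Measurable fun x ↦ (f x).re := Complex.measurable_re.comp hf.measurable
  have hmi : Measurable fun x ↦ (f x).im := Complex.measurable_im.comp hf.measurable
  have hzr : ∀ x, x ∉ Icc (-a) a → (f x).re = 0 := fun x hx ↦ by rw [hf.eq_zero x hx, Complex.zero_re]
  have hzi : ∀ x, x ∉ Icc (-a) a → (f x).im = 0 := fun x hx ↦ by rw [hf.eq_zero x hx, Complex.zero_im]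
  -- the real and imaginary parts obey the certified joint bound
  have hu := jointShiftBound_le_10397_real ha' hmr hre hzr
  have hv := jointShiftBound_le_10397_real ha' hmi him hzi
  -- `Re ∫ f(x+t) conj f(x) = ∫ u(x−t)u(x) + ∫ v(x−t)v(x)`
  have hsplit : ∀ t : ℝ, (∫ x, f (x + t) * conj (f x)).re =
      (∫ x, (fun y ↦ (f y).re) (x - t) * (fun y ↦ (f y).re) x) +
        ∫ x, (fun y ↦ (f y).im) (x - t) * (fun y ↦ (f y).im) x := by
    intro t
    rw [re_integral_shift_mul_conj hf t,
      integral_add (integrable_shift_mul_of_window hmr hre hmr hre hzr t)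
        (integrable_shift_mul_of_window hmi him hmi him hzi t)]
    simp only
    rw [integral_shift_add_mul_eq_sub (fun y ↦ (f y).re) t, integral_shift_add_mul_eq_sub (fun y ↦ (f y).im) t]
  rw [hsplit, hsplit, hsplit, hsplit, hsplit, integral_norm_sq_eq_add hf]
  simp only at hu hv ⊢
  nlinarith [hu, hv]

end Joint

/-! ## Bookkeeping: the prime index set of the window lies in `{0,…,7}` -/

section Index

variable {a : ℝ}

/-- `e^{2a} < 8` for `a ≤ 10397/10000` (`log 8 = 3 log 2 > 2.0794`). -/
theorem exp_two_mul_lt_eight (ha' : a ≤ 10397 / 10000) : Real.exp (2 * a) < 8 := by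
  have h2 : (0.6931471803 : ℝ) < Real.log 2 := Real.log_two_gt_d9
  have h8 : Real.log 8 = 3 * Real.log 2 := by
    rw [show (8 : ℝ) = 2 ^ 3 by norm_num, Real.log_pow]; norm_num
  have hlt : 2 * a < Real.log 8 := by rw [h8]; linarith
  calc Real.exp (2 * a) < Real.exp (Real.log 8) := Real.exp_lt_exp.2 hlt
    _ = 8 := Real.exp_log (by norm_num)

/-- For `a ≤ 10397/10000`: a sum over `weilPrimeIndex a` of terms that VANISH when `2a ≤ log k` is the sum over
`k < 8` of the same terms. -/
theorem sum_weilPrimeIndex_eq_sum_range_eight (ha' : a ≤ 10397 / 10000) (F : ℕ → ℝ)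
    (hF : ∀ k : ℕ, 2 * a ≤ Real.log k → F k = 0) :
    ∑ k ∈ weilPrimeIndex a, F k = ∑ k ∈ Finset.range 8, F k := by
  have hsub : weilPrimeIndex a ⊆ Finset.range 8 := by
    intro k hk
    have hk' := mem_weilPrimeIndex.1 hk
    rw [Finset.mem_range]
    by_contra hge
    push Not at hge
    have hk8 : (8 : ℝ) ≤ k := by exact_mod_cast hge
    have hpos : (0 : ℝ) < k := by linarith
    have : Real.log 8 ≤ Real.log k := Real.log_le_log (by norm_num) hk8
    have h8 : 2 * a < Real.log 8 := by
      have := exp_two_mul_lt_eight ha'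
      have h := Real.log_lt_log (Real.exp_pos _) this
      rwa [Real.log_exp] at h
    linarith
  refine Finset.sum_subset hsub fun k hk8 hk ↦ ?_
  -- `k < 8` not in the index set ⇒ `log k ≥ 2a` ⇒ the term vanishes
  refine hF k ?_
  by_contra hlt
  push Not at hlt
  exact hk (mem_weilPrimeIndex.2 hlt)

/-- The von Mangoldt values on `{0,…,7}`. -/
theorem vonMangoldt_values :
    Λ 0 = 0 ∧ Λ 1 = 0 ∧ Λ 2 = Real.log 2 ∧ Λ 3 = Real.log 3 ∧ Λ 4 = Real.log 2 ∧ Λ 5 = Real.log 5 ∧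
      Λ 6 = 0 ∧ Λ 7 = Real.log 7 := by
  refine ⟨by simp, ArithmeticFunction.vonMangoldt_apply_one,
    ArithmeticFunction.vonMangoldt_apply_prime Nat.prime_two,
    ArithmeticFunction.vonMangoldt_apply_prime Nat.prime_three, ?_,
    ArithmeticFunction.vonMangoldt_apply_prime (by norm_num), ?_,
    ArithmeticFunction.vonMangoldt_apply_prime (by norm_num)⟩
  · rw [show (4 : ℕ) = 2 ^ 2 by norm_num, ArithmeticFunction.vonMangoldt_apply_pow two_ne_zero]
    exact ArithmeticFunction.vonMangoldt_apply_prime Nat.prime_two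
  · exact ArithmeticFunction.vonMangoldt_eq_zero_iff.2 (by decide)

end Index

/-! ## The prime form bound with the joint-phantom constant -/

section Prime

variable {a : ℝ}

/-- **PRIME ⪰ −(2387/1000)·1 on every finite set of modes, for every window `0 < a ≤ 10397/10000`.**
`−(2387/1000)·Σ_{n∈s}|c_n|² ≤ Σ_{n,m∈s} Re(conj c_n c_m)·primeCoeff a n m` — the joint-phantom (K2) replacement of
`WeilFormatC.primeCoeff_form_ge` (path-graph `A_op⁺ = 3.129` on the `(log 7)/2…(log 8)/2` cell); uniform in `s`,
it is hypothesis `hP` of `WeilFormatC.farBlock_ge_dhat` with `A := 2387/1000`. -/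
theorem primeCoeff_form_ge_joint (ha : 0 < a) (ha' : a ≤ 10397 / 10000) (s : Finset ℤ) (c : ℤ → ℂ) :
    -((2387 / 1000 : ℝ) * ∑ n ∈ s, ‖c n‖ ^ 2)
      ≤ ∑ n ∈ s, ∑ m ∈ s, (conj (c n) * c m).re * primeCoeff a n m := by
  set f : ℝ → ℂ := ∑ n ∈ s, c n • chi a n with hfdef
  have hf : IsWindowFunction a f := IsWindowFunction.sum s c fun n _ ↦ isWindowFunction_chi ha n
  set X : ℕ → ℝ := fun k ↦ 2 * (∫ x, f (x + Real.log k) * conj (f x)).re with hXdef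
  -- the prime form as a sum over shift lengths
  have e : ∑ n ∈ s, ∑ m ∈ s, (conj (c n) * c m).re * primeCoeff a n m
      = ∑ k ∈ weilPrimeIndex a, -((Λ k : ℝ) / Real.sqrt k * X k) := by
    calc ∑ n ∈ s, ∑ m ∈ s, (conj (c n) * c m).re * primeCoeff a n m
        = ∑ n ∈ s, ∑ m ∈ s, ∑ k ∈ weilPrimeIndex a, (Λ k : ℝ) / Real.sqrt k *
            ((conj (c n) * c m).re * (incrCoeff a (Real.log k) n m - if n = m then 2 else 0)) := by
          refine Finset.sum_congr rfl fun n _ ↦ Finset.sum_congr rfl fun m _ ↦ ?_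
          rw [primeCoeff, Finset.mul_sum]
          refine Finset.sum_congr rfl fun k _ ↦ by ring
      _ = ∑ n ∈ s, ∑ k ∈ weilPrimeIndex a, ∑ m ∈ s, (Λ k : ℝ) / Real.sqrt k *
            ((conj (c n) * c m).re * (incrCoeff a (Real.log k) n m - if n = m then 2 else 0)) :=
          Finset.sum_congr rfl fun n _ ↦ Finset.sum_comm
      _ = ∑ k ∈ weilPrimeIndex a, ∑ n ∈ s, ∑ m ∈ s, (Λ k : ℝ) / Real.sqrt k *
            ((conj (c n) * c m).re * (incrCoeff a (Real.log k) n m - if n = m then 2 else 0)) :=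
          Finset.sum_comm
      _ = ∑ k ∈ weilPrimeIndex a, (Λ k : ℝ) / Real.sqrt k *
            ∑ n ∈ s, ∑ m ∈ s, (conj (c n) * c m).re * (incrCoeff a (Real.log k) n m - if n = m then 2 else 0) := by
          refine Finset.sum_congr rfl fun k _ ↦ ?_
          rw [Finset.mul_sum]
          refine Finset.sum_congr rfl fun n _ ↦ ?_
          rw [Finset.mul_sum]
      _ = ∑ k ∈ weilPrimeIndex a, -((Λ k : ℝ) / Real.sqrt k * X k) := by
          refine Finset.sum_congr rfl fun k hk ↦ ?_
          by_cases hΛ : (Λ k : ℝ) = 0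
          · rw [hΛ]; simp
          have hk2 : 2 ≤ k := by
            by_contra h
            have : k = 0 ∨ k = 1 := by omega
            rcases this with rfl | rfl
            · exact hΛ (by simp)
            · exact hΛ (by simp)
          have ht : 0 < Real.log k := Real.log_pos (by exact_mod_cast hk2)
          have ht2 : Real.log k ≤ 2 * a := (mem_weilPrimeIndex.1 hk).le
          rw [sum_sum_re_mul_incrCoeff_sub_two_eq ha s c ht.le ht2, hXdef]
          ring
  -- terms with `log k ≥ 2a` vanish (the shift is invisible on the window)
  have hXzero : ∀ k : ℕ, 2 * a ≤ Real.log k → X k = 0 := by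
    intro k hk
    obtain ⟨S, hS0, hS⟩ := hf.bounded'
    have hre : ∀ x, |(f x).re| ≤ S := fun x ↦ (Complex.abs_re_le_norm _).trans (hS x)
    have him : ∀ x, |(f x).im| ≤ S := fun x ↦ (Complex.abs_im_le_norm _).trans (hS x)
    have hmr : Measurable fun x ↦ (f x).re := Complex.measurable_re.comp hf.measurable
    have hmi : Measurable fun x ↦ (f x).im := Complex.measurable_im.comp hf.measurable
    have hzr : ∀ x, x ∉ Icc (-a) a → (f x).re = 0 := fun x hx ↦ by rw [hf.eq_zero x hx, Complex.zero_re]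
    have hzi : ∀ x, x ∉ Icc (-a) a → (f x).im = 0 := fun x hx ↦ by rw [hf.eq_zero x hx, Complex.zero_im]
    simp only [hXdef]
    rw [re_integral_shift_mul_conj hf,
      integral_add (integrable_shift_mul_of_window hmr hre hmr hre hzr _)
        (integrable_shift_mul_of_window hmi him hmi him hzi _)]
    rw [integral_shift_add_mul_eq_sub (fun y ↦ (f y).re), integral_shift_add_mul_eq_sub (fun y ↦ (f y).im),
      integral_shift_mul_eq_zero_of_le hzr hk, integral_shift_mul_eq_zero_of_le hzi hk]
    ring
  have hsum : ∑ k ∈ weilPrimeIndex a, -((Λ k : ℝ) / Real.sqrt k * X k) =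
      ∑ k ∈ Finset.range 8, -((Λ k : ℝ) / Real.sqrt k * X k) :=
    sum_weilPrimeIndex_eq_sum_range_eight ha' _ fun k hk ↦ by rw [hXzero k hk, mul_zero, neg_zero]
  -- evaluate the sum over `k < 8`
  obtain ⟨hΛ0, hΛ1, hΛ2, hΛ3, hΛ4, hΛ5, hΛ6, hΛ7⟩ := vonMangoldt_values
  have hs4 : Real.sqrt ((4 : ℕ) : ℝ) = 2 := by
    rw [show ((4 : ℕ) : ℝ) = 2 ^ 2 by norm_num, Real.sqrt_sq (by norm_num)]
  have hjoint := joint_re_integral_shift_le ha' hf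
  have hD : (certA10397.D : ℝ) ≤ 2387 / 1000 := by
    have hq : certA10397.D ≤ 2387 / 1000 := by
      show (3687749179501858510188167491457929667037239113337390890010811094191434390315738576145388397788218575953 : ℚ) / 1545570708295023398334612797446033485277938817481404064292774961923311707983969283115695548808157986816 ≤ 2387 / 1000
      norm_num
    calc (certA10397.D : ℝ) ≤ ((2387 / 1000 : ℚ) : ℝ) := Rat.cast_le.2 hq
      _ = 2387 / 1000 := by norm_num
  have hnorm := integral_norm_sq_sum_smul_chi ha s c
  have hE : 0 ≤ ∫ x, ‖f x‖ ^ 2 := integral_nonneg fun x ↦ sq_nonneg _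
  rw [e, hsum]
  simp only [Finset.sum_range_succ, Finset.sum_range_zero, hΛ0, hΛ1, hΛ2, hΛ3, hΛ4, hΛ5, hΛ6, hΛ7,
    zero_div, zero_mul, neg_zero, zero_add, add_zero, hs4, hXdef]
  rw [← hnorm]
  have h4 : Real.log ((4 : ℕ) : ℝ) = 2 * Real.log 2 := by
    rw [show ((4 : ℕ) : ℝ) = 2 ^ 2 by norm_num, Real.log_pow]; norm_num
  simp only [Nat.cast_ofNat] at h4 ⊢
  rw [h4]
  nlinarith [hjoint, mul_le_mul_of_nonneg_right hD hE]

end Prime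

end Summit.RiemannHypothesis.RiemannHypothesis.Theorems.WeilFormatC
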